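import Mathlib
import Summits.RiemannHypothesis.RiemannHypothesis.Theorems.HandoffSplitKernel
import HarnessLib

/-!
# The verified Gram form dominates the Gram sum over any finite list of certified zeros (handoff prove-1, ATTEMPT-17 §5; the zero-list link of LEMMA TB)

THEOREM V's verified Gram form is `𝒱_φ(g) = Σ_{ρ ∈ weilZeroIndex T₀} m(ρ) |ĝ(1/2 + i Im ρ)|² Φ(Im ρ)`
(`HandoffSplitKernel.verifiedGramK`), a `finsum` over ALL zeros of `ζ` with `0 ≤ Re ρ ≤ 1`,
`0 < |Im ρ| ≤ T₀`.  A LEMMA-TB certificate (HOME handoff/prove-1/ATTEMPT-16.md §4) uses instead a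
finite list `Z` of ordinates `γ ∈ (0, T₀]` with `ζ(1/2 + iγ) = 0` (Arb balls each containing a zero on
the line).  This file proves the link asserted in prose in ATTEMPT-16 §5 (ε): for a split kernel
(`Φ ≥ 0`) and every `g`,

  `Σ_{γ ∈ Z} ( |ĝ(1/2 + iγ)|² Φ(γ) + |ĝ(1/2 - iγ)|² Φ(-γ) ) ≤ 𝒱_φ(g)`

(`sum_lowLineDensityK_le_verifiedGramK`): both `1/2 + iγ` and its conjugate `1/2 - iγ`
(`riemannZeta_conj`) lie in `weilZeroIndex T₀`, each with multiplicity `m(ρ) ≥ 1`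
(`riemannZetaZeroOrder_pos_iff`), every term of `𝒱_φ` is non-negative, and zeros not in the list are
dropped.  No completeness of the list and no simplicity of the zeros is needed.  Nothing in this file
bears on the truth of RH.
-/

set_option linter.dupNamespace false

open scoped Real ComplexConjugate
open Complex Set MeasureTheory Literature.NumberTheory.LFunctions

namespace Summit.RiemannHypothesis.RiemannHypothesis.Theorems

variable {g φ : ℝ → ℂ} {δ : ℝ}

/-- `1/2 + iγ` with `ζ(1/2 + iγ) = 0`, `0 < γ ≤ T₀` lies in `weilZeroIndex T₀`. -/
theorem half_add_mem_weilZeroIndex {γ T₀ : ℝ} (hz : riemannZeta (1 / 2 + γ * I) = 0) (hγ : 0 < γ)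
    (hT : γ ≤ T₀) : (1 / 2 + γ * I : ℂ) ∈ weilZeroIndex T₀ := by
  refine ⟨hz, ?_, ?_, ?_, ?_⟩ <;> norm_num [abs_of_pos hγ, hγ.ne', hT]

/-- `1/2 - iγ` (the conjugate zero) lies in `weilZeroIndex T₀` as well. -/
theorem half_sub_mem_weilZeroIndex {γ T₀ : ℝ} (hz : riemannZeta (1 / 2 + γ * I) = 0) (hγ : 0 < γ)
    (hT : γ ≤ T₀) : (1 / 2 - γ * I : ℂ) ∈ weilZeroIndex T₀ := by
  have hconj : (1 / 2 - γ * I : ℂ) = conj (1 / 2 + γ * I) := by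
    simp only [map_add, map_div₀, map_one, map_ofNat, map_mul, Complex.conj_ofReal, Complex.conj_I]
    ring
  have hz' : riemannZeta (1 / 2 - γ * I) = 0 := by rw [hconj, riemannZeta_conj, hz, map_zero]
  refine ⟨hz', ?_, ?_, ?_, ?_⟩ <;> norm_num [abs_of_pos hγ, hγ.ne', hT]

/-- At a point of `weilZeroIndex T₀` the multiplicity is at least one. -/
theorem one_le_riemannZetaZeroOrder_of_mem {T₀ : ℝ} {ρ : ℂ} (hρ : ρ ∈ weilZeroIndex T₀) :
    (1 : ℝ) ≤ riemannZetaZeroOrder ρ := by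
  have hne : ρ ≠ 1 := fun h ↦ hρ.2.2.2.1 (by rw [h]; simp)
  have hpos : 0 < riemannZetaZeroOrder ρ := (riemannZetaZeroOrder_pos_iff hne).2 hρ.1
  exact_mod_cast hpos

/-- **The verified Gram form dominates any finite list of certified zeros.** For a split kernel
`φ`, every `g`, and a finite set `Z` of ordinates `γ` with `ζ(1/2 + iγ) = 0`, `0 < γ ≤ T₀`:
`Σ_{γ ∈ Z} (G(γ) + G(-γ)) ≤ 𝒱_φ(g)`, `G(t) = |ĝ(1/2 + it)|² Φ(t)`. -/
theorem sum_lowLineDensityK_le_verifiedGramK (hφ : IsSplitKernel φ δ) (g : ℝ → ℂ) {T₀ : ℝ}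
    (Z : Finset ℝ) (hZ : ∀ γ ∈ Z, riemannZeta (1 / 2 + γ * I) = 0 ∧ 0 < γ ∧ γ ≤ T₀) :
    ∑ γ ∈ Z, (lowLineDensityK g φ γ + lowLineDensityK g φ (-γ)) ≤ verifiedGramK g φ T₀ := by
  classical
  have hfin := weilZeroIndex_finite T₀
  set S := hfin.toFinset with hS
  -- the two injections `γ ↦ 1/2 ± iγ`
  set ιp : ℝ → ℂ := fun γ ↦ 1 / 2 + γ * I with hιp
  set ιm : ℝ → ℂ := fun γ ↦ 1 / 2 - γ * I with hιm
  have him_p : ∀ γ : ℝ, (ιp γ).im = γ := fun γ ↦ by simp [hιp]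
  have him_m : ∀ γ : ℝ, (ιm γ).im = -γ := fun γ ↦ by simp [hιm]
  have hinj_p : Set.InjOn ιp Z := fun x _ y _ h ↦ by simpa [him_p] using congrArg Complex.im h
  have hinj_m : Set.InjOn ιm Z := fun x _ y _ h ↦ by
    have := congrArg Complex.im h; simpa [him_m] using this
  have hsub_p : Z.image ιp ⊆ S := by
    intro ρ hρ
    obtain ⟨γ, hγ, rfl⟩ := Finset.mem_image.1 hρ
    obtain ⟨hz, h0, hT⟩ := hZ γ hγ
    exact hfin.mem_toFinset.2 (half_add_mem_weilZeroIndex hz h0 hT)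
  have hsub_m : Z.image ιm ⊆ S := by
    intro ρ hρ
    obtain ⟨γ, hγ, rfl⟩ := Finset.mem_image.1 hρ
    obtain ⟨hz, h0, hT⟩ := hZ γ hγ
    exact hfin.mem_toFinset.2 (half_sub_mem_weilZeroIndex hz h0 hT)
  have hdisj : Disjoint (Z.image ιp) (Z.image ιm) := by
    rw [Finset.disjoint_left]
    intro ρ h1 h2
    obtain ⟨γ, hγ, rfl⟩ := Finset.mem_image.1 h1
    obtain ⟨γ', hγ', he⟩ := Finset.mem_image.1 h2
    have := congrArg Complex.im he
    rw [him_m, him_p] at this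
    linarith [(hZ γ hγ).2.1, (hZ γ' hγ').2.1]
  -- the summand of `𝒱_φ` and its non-negativity
  set f : ℂ → ℝ := fun ρ ↦ (riemannZetaZeroOrder ρ : ℝ) * lowLineDensityK g φ ρ.im with hf
  have hf0 : ∀ ρ ∈ S, 0 ≤ f ρ := fun ρ hρ ↦
    mul_nonneg (zero_le_one.trans (one_le_riemannZetaZeroOrder_of_mem (hfin.mem_toFinset.1 hρ)))
      (lowLineDensityK_nonneg hφ g _)
  have hV : verifiedGramK g φ T₀ = ∑ ρ ∈ S, f ρ := by
    rw [verifiedGramK, finsum_mem_eq_finite_toFinset_sum _ hfin]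
  -- compare
  have hle : ∑ ρ ∈ Z.image ιp ∪ Z.image ιm, f ρ ≤ ∑ ρ ∈ S, f ρ :=
    Finset.sum_le_sum_of_subset_of_nonneg (Finset.union_subset hsub_p hsub_m)
      (fun ρ hρ _ ↦ hf0 ρ hρ)
  rw [Finset.sum_union hdisj, Finset.sum_image hinj_p, Finset.sum_image hinj_m] at hle
  rw [hV, Finset.sum_add_distrib]
  refine le_trans (add_le_add ?_ ?_) hle
  · refine Finset.sum_le_sum fun γ hγ ↦ ?_
    obtain ⟨hz, h0, hT⟩ := hZ γ hγ
    have h1 := one_le_riemannZetaZeroOrder_of_mem (half_add_mem_weilZeroIndex hz h0 hT)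
    have hG := lowLineDensityK_nonneg hφ g γ
    simp only [hf, him_p]
    nlinarith
  · refine Finset.sum_le_sum fun γ hγ ↦ ?_
    obtain ⟨hz, h0, hT⟩ := hZ γ hγ
    have h1 := one_le_riemannZetaZeroOrder_of_mem (half_sub_mem_weilZeroIndex hz h0 hT)
    have hG := lowLineDensityK_nonneg hφ g (-γ)
    simp only [hf, him_m]
    nlinarith

/-! ### Real tests and real kernels: the two half-lines carry the same Gram weight (appended 2026-08-24, prove-1 gen10) -/

/-- Conjugation symmetry of the transform of a REAL-valued function: `ĝ(conj s) = conj ĝ(s)`. -/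
theorem weilMellin_conj_eq_of_im_zero (hre : ∀ t, (g t).im = 0) (s : ℂ) :
    weilMellin g (conj s) = conj (weilMellin g s) := by
  unfold weilMellin
  rw [← integral_conj]
  refine MeasureTheory.integral_congr_ae (Filter.Eventually.of_forall fun t ↦ ?_)
  have hg : conj (g t) = g t := Complex.conj_eq_iff_im.2 (hre t)
  simp only [map_mul, hg, ← Complex.exp_conj, map_sub, map_div₀, map_one, map_ofNat,
    Complex.conj_ofReal]

/-- For real-valued `g`: `|ĝ(1/2 - it)| = |ĝ(1/2 + it)|`. -/
theorem norm_weilMellin_half_line_neg_of_im_zero (hre : ∀ t, (g t).im = 0) (t : ℝ) :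
    ‖weilMellin g (1 / 2 + (((-t : ℝ)) : ℂ) * I)‖ = ‖weilMellin g (1 / 2 + t * I)‖ := by
  have hs : (1 / 2 + (((-t : ℝ)) : ℂ) * I : ℂ) = conj (1 / 2 + (t : ℂ) * I) := by
    simp only [map_add, map_div₀, map_one, map_ofNat, map_mul, Complex.conj_ofReal, Complex.conj_I,
      Complex.ofReal_neg]
    ring
  rw [hs, weilMellin_conj_eq_of_im_zero hre, Complex.norm_conj]

/-- The line symbol of a REAL-valued kernel is even: `Φ(-t) = Φ(t)`. -/
theorem lineSymbol_neg_of_im_zero (hφre : ∀ x, (φ x).im = 0) (t : ℝ) :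
    lineSymbol φ (-t) = lineSymbol φ t := by
  unfold lineSymbol
  have hs : (1 / 2 + (((-t : ℝ)) : ℂ) * I : ℂ) = conj (1 / 2 + (t : ℂ) * I) := by
    simp only [map_add, map_div₀, map_one, map_ofNat, map_mul, Complex.conj_ofReal, Complex.conj_I,
      Complex.ofReal_neg]
    ring
  rw [hs, weilMellin_conj_eq_of_im_zero hφre, Complex.conj_re]

/-- For a real test and a real kernel the Gram weight is even: `G(-t) = G(t)`. -/
theorem lowLineDensityK_neg_of_im_zero (hre : ∀ t, (g t).im = 0) (hφre : ∀ x, (φ x).im = 0)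
    (t : ℝ) : lowLineDensityK g φ (-t) = lowLineDensityK g φ t := by
  unfold lowLineDensityK
  rw [norm_weilMellin_half_line_neg_of_im_zero hre, lineSymbol_neg_of_im_zero hφre]

/-- **Real test, real split kernel:** `2 Σ_{γ ∈ Z} |ĝ(1/2 + iγ)|² Φ(γ) ≤ 𝒱_φ(g)` for any finite list
`Z` of certified zero ordinates in `(0, T₀]` — the per-parity form used by the LEMMA-TB
certificates (even/odd real `g`; the flat kernels are real-valued). -/
theorem two_mul_sum_lowLineDensityK_le_verifiedGramK (hφ : IsSplitKernel φ δ)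
    (hφre : ∀ x, (φ x).im = 0) (hre : ∀ t, (g t).im = 0) {T₀ : ℝ} (Z : Finset ℝ)
    (hZ : ∀ γ ∈ Z, riemannZeta (1 / 2 + γ * I) = 0 ∧ 0 < γ ∧ γ ≤ T₀) :
    2 * ∑ γ ∈ Z, lowLineDensityK g φ γ ≤ verifiedGramK g φ T₀ := by
  have h := sum_lowLineDensityK_le_verifiedGramK hφ g Z hZ
  rw [Finset.mul_sum]
  refine le_trans (le_of_eq (Finset.sum_congr rfl fun γ _ ↦ ?_)) h
  rw [lowLineDensityK_neg_of_im_zero hre hφre, two_mul]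

end Summit.RiemannHypothesis.RiemannHypothesis.Theorems
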